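import Mathlib
import HarnessLib
import Summits.Ventures.LatticeQCDFlow.Scaling.AcceptanceVolumeFloorRigidity

/-!
# LatticeQCDFlow / Scaling — rigidity of the acceptance volume floor, `m` blocks:
# `∏ᵢ acc(pᵢ, qᵢ) = acc(⊗pᵢ, ⊗qᵢ)` iff ALL BLOCKS BUT AT MOST ONE ARE HIT-OR-MISS

HONEST FRAMING: exact (Metropolis-corrected) sampling algorithms for lattice gauge theory;
figures of merit are autocorrelation/cost numbers at stated couplings and volumes; no
continuum-physics claim.

Venture `LatticeQCDFlow` (cell pub-lqcd), topic `Scaling`; FANOUT row 3 (`s0-u1-a`, S0-B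
implementation A, GEN-13).  NEW WORK of the cell (elementary finite sums); NO definition is
introduced.  Companion of `Scaling/AcceptanceVolumeFloorRigidity` (imported: the two-block equality
case `acc(p₁⊗p₂, q₁⊗q₂) = acc₁·acc₂ ↔` one block hit-or-miss, strictness otherwise, and the
hit-or-miss calculus of two-block products), iterated over `m` independent blocks by peeling the first
block (`accRate_blockProd_succ`, `blockProd_comp_consEquiv` of row 3's `Scaling/AcceptanceVolumeSandwich`).
A pair `(p, q)` (target `p ≥ 0`, model `q > 0`) is HIT-OR-MISS when
`∀ z z′, 0 < p z → 0 < p z′ → w z = w z′`.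

* `hitOrMiss_comp_equiv_iff`, `hitOrMiss_blockProd_succ_iff` — relabelling / peeling;
* **`hitOrMiss_blockProd`** — a product of hit-or-miss blocks is hit-or-miss;
  **`not_hitOrMiss_blockProd`** — one block that is not makes the product not (normalised targets);
* `prod_accRate_eq_accRate_blockProd_of_pairwise` — all blocks but at most one hit-or-miss ⇒
  `∏ᵢ accᵢ = acc(⊗)`;
* **`prod_accRate_lt_accRate_blockProd`** — two distinct blocks not hit-or-miss ⇒ `∏ᵢ accᵢ < acc(⊗)`;
* **`prod_accRate_eq_accRate_blockProd_iff`** — for normalised nonnegative block targets and positive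
  block models: `∏ᵢ acc(pᵢ,qᵢ) = acc(⊗pᵢ, ⊗qᵢ) ↔ ∀ i ≠ j`, block `i` or block `j` is hit-or-miss;
  `pow_accRate_eq_accRate_blockProd_const_iff` — identical blocks: `acc₁^m = acc_m ↔ m ≤ 1 ∨` the
  block is hit-or-miss.

Reading (value-free): the floor `∏ᵢ accᵢ` of the acceptance of a factorised exact sampler — and
hence the decay rate `Σᵢ log(1/accᵢ)` — is exact only when every block except possibly one is an
all-or-nothing proposal; for identical imperfect graded blocks the true acceptance decays strictly
more slowly than `acc₁^m` from `m = 2` on.  NOT CLAIMED: the size of the excess; the general-space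
form; coupled flows; any number of ours.
-/

namespace Summit.Ventures.LatticeQCDFlow.Theory2

open Finset
open Summit.Ventures.LatticeQCDFlow.Exactness

/-! ## §3 `m` independent blocks -/

section Blocks

variable {Z : Type*} [Fintype Z] {m : ℕ}

omit [Fintype Z] in
/-- Hit-or-miss is invariant under relabelling the state space. [folklore] -/
theorem hitOrMiss_comp_equiv_iff {X Y : Type*} (e : X ≃ Y) (p q : Y → ℝ) :
    (∀ x x', 0 < (p ∘ e) x → 0 < (p ∘ e) x' → weight (p ∘ e) (q ∘ e) x = weight (p ∘ e) (q ∘ e) x')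
      ↔ ∀ y y', 0 < p y → 0 < p y' → weight p q y = weight p q y' := by
  have hw : ∀ x, weight (p ∘ e) (q ∘ e) x = weight p q (e x) := fun x => rfl
  simp only [Function.comp_apply, hw]
  constructor
  · intro h y y' hy hy'
    have := h (e.symm y) (e.symm y') (by simpa using hy) (by simpa using hy')
    simpa using this
  · intro h x x' hx hx'
    exact h _ _ hx hx'

omit [Fintype Z] in
/-- Hit-or-miss for the `(m+1)`-block product iff for block `0` times the tail product. [ours] -/
theorem hitOrMiss_blockProd_succ_iff (pb qb : Fin (m + 1) → Z → ℝ) :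
    (∀ φ φ', 0 < blockProd pb φ → 0 < blockProd pb φ' →
        weight (blockProd pb) (blockProd qb) φ = weight (blockProd pb) (blockProd qb) φ') ↔
      ∀ z z', 0 < prodLaw (pb 0) (blockProd (Fin.tail pb)) z →
        0 < prodLaw (pb 0) (blockProd (Fin.tail pb)) z' →
        weight (prodLaw (pb 0) (blockProd (Fin.tail pb))) (prodLaw (qb 0) (blockProd (Fin.tail qb))) z
          = weight (prodLaw (pb 0) (blockProd (Fin.tail pb)))
              (prodLaw (qb 0) (blockProd (Fin.tail qb))) z' := by
  rw [← blockProd_comp_consEquiv pb, ← blockProd_comp_consEquiv qb,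
    hitOrMiss_comp_equiv_iff (Fin.consEquiv fun _ : Fin (m + 1) => Z)]

omit [Fintype Z] in
/-- **A product of hit-or-miss blocks is hit-or-miss.** [ours] -/
theorem hitOrMiss_blockProd {pb qb : Fin m → Z → ℝ} (hp : ∀ i z, 0 ≤ pb i z)
    (h : ∀ i, ∀ z z', 0 < pb i z → 0 < pb i z' → weight (pb i) (qb i) z = weight (pb i) (qb i) z') :
    ∀ φ φ', 0 < blockProd pb φ → 0 < blockProd pb φ' →
      weight (blockProd pb) (blockProd qb) φ = weight (blockProd pb) (blockProd qb) φ' := by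
  induction m with
  | zero => intro φ φ' _ _; rw [Subsingleton.elim φ φ']
  | succ m ih =>
    rw [hitOrMiss_blockProd_succ_iff]
    exact hitOrMiss_prodLaw (hp 0) (h 0) (ih (fun i z => hp _ _) fun i => h i.succ)

/-- **A product with one block that is not hit-or-miss is not hit-or-miss** (normalised block
targets, positive block models). [ours] -/
theorem not_hitOrMiss_blockProd {pb qb : Fin m → Z → ℝ} (hq : ∀ i z, 0 < qb i z)
    (hp1 : ∀ i, ∑ z, pb i z = 1) {j : Fin m}
    (hj : ¬ ∀ z z', 0 < pb j z → 0 < pb j z' → weight (pb j) (qb j) z = weight (pb j) (qb j) z') :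
    ¬ ∀ φ φ', 0 < blockProd pb φ → 0 < blockProd pb φ' →
      weight (blockProd pb) (blockProd qb) φ = weight (blockProd pb) (blockProd qb) φ' := by
  induction m with
  | zero => exact j.elim0
  | succ m ih =>
    rw [hitOrMiss_blockProd_succ_iff]
    refine Fin.cases (motive := fun j => (¬ ∀ z z', 0 < pb j z → 0 < pb j z' →
      weight (pb j) (qb j) z = weight (pb j) (qb j) z') → _) ?_ (fun j' => ?_) j hj
    · intro h0
      exact not_hitOrMiss_prodLaw_left (fun φ => prod_pos fun i _ => hq _ _)
        (sum_blockProd_eq_one fun i => hp1 i.succ) h0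
    · intro hj'
      exact not_hitOrMiss_prodLaw_right (hq 0) (hp1 0)
        (ih (fun i z => hq _ _) (fun i => hp1 i.succ) hj')

/-- **All blocks but at most one hit-or-miss ⇒ the floor is attained**:
`∏ᵢ acc(pᵢ,qᵢ) = acc(⊗pᵢ, ⊗qᵢ)`. [ours] -/
theorem prod_accRate_eq_accRate_blockProd_of_pairwise {pb qb : Fin m → Z → ℝ}
    (hp : ∀ i z, 0 ≤ pb i z) (hq : ∀ i z, 0 < qb i z)
    (H : ∀ i j, i ≠ j →
      (∀ z z', 0 < pb i z → 0 < pb i z' → weight (pb i) (qb i) z = weight (pb i) (qb i) z') ∨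
      (∀ z z', 0 < pb j z → 0 < pb j z' → weight (pb j) (qb j) z = weight (pb j) (qb j) z')) :
    ∏ i, accRate (pb i) (qb i) = accRate (blockProd pb) (blockProd qb) := by
  induction m with
  | zero => rw [accRate_blockProd_zero]; simp
  | succ m ih =>
    rw [Fin.prod_univ_succ, accRate_blockProd_succ,
      ih (fun i z => hp _ _) (fun i z => hq _ _) (fun i j hij => H i.succ j.succ
        fun h => hij (Fin.succ_injective _ h))]
    have hP : ∀ φ, 0 ≤ blockProd (Fin.tail pb) φ := fun φ => prod_nonneg fun i _ => hp _ _
    have hQ : ∀ φ, 0 < blockProd (Fin.tail qb) φ := fun φ => prod_pos fun i _ => hq _ _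
    refine ((accRate_prodLaw_eq_mul_iff (hp 0) (hq 0) hP hQ).2 ?_).symm
    by_cases h0 : ∀ z z', 0 < pb 0 z → 0 < pb 0 z' → weight (pb 0) (qb 0) z = weight (pb 0) (qb 0) z'
    · exact Or.inl h0
    · refine Or.inr (hitOrMiss_blockProd (fun i z => hp _ _) fun i => ?_)
      exact (H 0 i.succ (Fin.succ_ne_zero i).symm).resolve_left h0

/-- **Two distinct blocks not hit-or-miss ⇒ the floor is STRICT**: `∏ᵢ acc(pᵢ,qᵢ) < acc(⊗pᵢ, ⊗qᵢ)`
(normalised targets, positive models). [ours] -/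
theorem prod_accRate_lt_accRate_blockProd {pb qb : Fin m → Z → ℝ} (hp : ∀ i z, 0 ≤ pb i z)
    (hq : ∀ i z, 0 < qb i z) (hp1 : ∀ i, ∑ z, pb i z = 1) {i j : Fin m} (hij : i ≠ j)
    (hi : ¬ ∀ z z', 0 < pb i z → 0 < pb i z' → weight (pb i) (qb i) z = weight (pb i) (qb i) z')
    (hj : ¬ ∀ z z', 0 < pb j z → 0 < pb j z' → weight (pb j) (qb j) z = weight (pb j) (qb j) z') :
    ∏ i, accRate (pb i) (qb i) < accRate (blockProd pb) (blockProd qb) := by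
  induction m with
  | zero => exact i.elim0
  | succ m ih =>
    rw [Fin.prod_univ_succ, accRate_blockProd_succ]
    have hP : ∀ φ, 0 ≤ blockProd (Fin.tail pb) φ := fun φ => prod_nonneg fun i _ => hp _ _
    have hQ : ∀ φ, 0 < blockProd (Fin.tail qb) φ := fun φ => prod_pos fun i _ => hq _ _
    have hP1 : ∑ φ, blockProd (Fin.tail pb) φ = 1 := sum_blockProd_eq_one fun i => hp1 i.succ
    have htail : ∏ k : Fin m, accRate (pb k.succ) (qb k.succ)
        ≤ accRate (blockProd (Fin.tail pb)) (blockProd (Fin.tail qb)) :=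
      prod_accRate_le_accRate_blockProd (fun i z => hp _ _) fun i z => (hq _ _).le
    have h0 : 0 ≤ accRate (pb 0) (qb 0) := accRate_nonneg (hp 0) fun z => (hq 0 z).le
    -- a block that is not hit-or-miss in the tail makes the tail product not hit-or-miss
    have key : ∀ {k : Fin m}, (¬ ∀ z z', 0 < pb k.succ z → 0 < pb k.succ z' →
        weight (pb k.succ) (qb k.succ) z = weight (pb k.succ) (qb k.succ) z') →
        ¬ ∀ φ φ', 0 < blockProd (Fin.tail pb) φ → 0 < blockProd (Fin.tail pb) φ' →
          weight (blockProd (Fin.tail pb)) (blockProd (Fin.tail qb)) φ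
            = weight (blockProd (Fin.tail pb)) (blockProd (Fin.tail qb)) φ' := fun hk =>
      not_hitOrMiss_blockProd (pb := Fin.tail pb) (qb := Fin.tail qb) (fun i z => hq _ _)
        (fun i => hp1 i.succ) hk
    -- case analysis on whether `i` or `j` is block `0`
    have main : ∀ {i j : Fin (m + 1)}, i ≠ j → i = 0 →
        (¬ ∀ z z', 0 < pb i z → 0 < pb i z' → weight (pb i) (qb i) z = weight (pb i) (qb i) z') →
        (¬ ∀ z z', 0 < pb j z → 0 < pb j z' → weight (pb j) (qb j) z = weight (pb j) (qb j) z') →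
        accRate (pb 0) (qb 0) * ∏ k : Fin m, accRate (pb k.succ) (qb k.succ)
          < accRate (prodLaw (pb 0) (blockProd (Fin.tail pb)))
              (prodLaw (qb 0) (blockProd (Fin.tail qb))) := by
      intro i j hij hi0 hi hj
      subst hi0
      obtain ⟨j', rfl⟩ := Fin.exists_succ_eq.2 hij.symm
      calc accRate (pb 0) (qb 0) * ∏ k : Fin m, accRate (pb k.succ) (qb k.succ)
          ≤ accRate (pb 0) (qb 0) * accRate (blockProd (Fin.tail pb)) (blockProd (Fin.tail qb)) :=
            mul_le_mul_of_nonneg_left htail h0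
        _ < _ := mul_accRate_lt_accRate_prodLaw (hp 0) (hq 0) hP hQ hi (key hj)
    by_cases hi0 : i = 0
    · exact main hij hi0 hi hj
    by_cases hj0 : j = 0
    · exact main hij.symm hj0 hj hi
    obtain ⟨i', rfl⟩ := Fin.exists_succ_eq.2 hi0
    obtain ⟨j', rfl⟩ := Fin.exists_succ_eq.2 hj0
    have hlt := ih (pb := Fin.tail pb) (qb := Fin.tail qb) (fun i z => hp _ _) (fun i z => hq _ _)
      (fun i => hp1 i.succ) (fun h => hij (congrArg Fin.succ h)) hi hj
    have h0pos : 0 < accRate (pb 0) (qb 0) := accRate_pos_of_normalised (hp 0) (hq 0) (hp1 0)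
    calc accRate (pb 0) (qb 0) * ∏ k : Fin m, accRate (pb k.succ) (qb k.succ)
        < accRate (pb 0) (qb 0) * accRate (blockProd (Fin.tail pb)) (blockProd (Fin.tail qb)) :=
          mul_lt_mul_of_pos_left hlt h0pos
      _ ≤ _ := mul_accRate_le_accRate_prodLaw (hp 0) (fun z => (hq 0 z).le) hP fun φ => (hQ φ).le

/-- **RIGIDITY OF THE ACCEPTANCE VOLUME FLOOR**: for normalised nonnegative block targets and
positive block models, `∏ᵢ acc(pᵢ,qᵢ) = acc(⊗pᵢ, ⊗qᵢ)` iff for every two distinct blocks at least one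
is hit-or-miss — i.e. ALL BLOCKS BUT AT MOST ONE ARE HIT-OR-MISS. [ours] -/
theorem prod_accRate_eq_accRate_blockProd_iff {pb qb : Fin m → Z → ℝ} (hp : ∀ i z, 0 ≤ pb i z)
    (hq : ∀ i z, 0 < qb i z) (hp1 : ∀ i, ∑ z, pb i z = 1) :
    ∏ i, accRate (pb i) (qb i) = accRate (blockProd pb) (blockProd qb) ↔
      ∀ i j, i ≠ j →
        (∀ z z', 0 < pb i z → 0 < pb i z' → weight (pb i) (qb i) z = weight (pb i) (qb i) z') ∨
        (∀ z z', 0 < pb j z → 0 < pb j z' → weight (pb j) (qb j) z = weight (pb j) (qb j) z') := by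
  refine ⟨fun h i j hij => ?_, prod_accRate_eq_accRate_blockProd_of_pairwise hp hq⟩
  by_contra H
  obtain ⟨hi, hj⟩ := not_or.1 H
  exact (prod_accRate_lt_accRate_blockProd hp hq hp1 hij hi hj).ne h

/-- **Identical blocks**: `acc(p₀,q₀)^m = acc(p₀^{⊗m}, q₀^{⊗m})` iff `m ≤ 1` or the block is
hit-or-miss. [ours] -/
theorem pow_accRate_eq_accRate_blockProd_const_iff {p₀ q₀ : Z → ℝ} (hp : ∀ z, 0 ≤ p₀ z)
    (hq : ∀ z, 0 < q₀ z) (hp1 : ∑ z, p₀ z = 1) :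
    accRate p₀ q₀ ^ m = accRate (blockProd fun _ : Fin m => p₀) (blockProd fun _ : Fin m => q₀) ↔
      m ≤ 1 ∨ ∀ z z', 0 < p₀ z → 0 < p₀ z' → weight p₀ q₀ z = weight p₀ q₀ z' := by
  rw [← Fin.prod_const m (accRate p₀ q₀),
    prod_accRate_eq_accRate_blockProd_iff (pb := fun _ : Fin m => p₀) (qb := fun _ => q₀)
      (fun _ z => hp z) (fun _ z => hq z) fun _ => hp1]
  simp only [or_self]
  constructor
  · intro h
    by_cases hm : m ≤ 1
    · exact Or.inl hm
    · have hm' : 1 < m := not_le.1 hm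
      exact Or.inr (h ⟨0, by omega⟩ ⟨1, hm'⟩ (by simp [Fin.ext_iff]))
  · rintro (hm | h) i j hij
    · exact absurd (Fin.ext (by omega : (i : ℕ) = j)) hij
    · exact h

end Blocks

end Summit.Ventures.LatticeQCDFlow.Theory2
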